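import Summits.NavierStokesRegularity.NavierStokesRegularity.Theorems.RellichScarSymmetricScarExistsApexRieszPressureUnitScale
import Literature.Analysis.FluidPDE.ClassicalSolutionRescale

/-!
# Crux `SymmetricScarExists` (stmt-NavierStokesRegularity-11718), line `logtime-bernoulli-certificate`:
# stub `stub_apexScaleInvariantBounds` — the Riesz pressure, III: dilation covariance and the
# scale-invariant bounds (registered sub-goal `apexRieszPressure_scaleInvariantBounds`)

Helper file (`--supports stmt-NavierStokesRegularity-11718`; theorems only, no definitions, no named
facts), sequel of `…ApexRieszPressureUnitScale.lean`, completing the POINTWISE part of the pressure half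
of the stub `stub_apexScaleInvariantBounds`: for every classical Type-I solution `(v, q)` of Navier–Stokes
(`ν = 1`, `f = 0`) on `(−∞, 0) × ℝ³` with `‖v(t,x)‖ ≤ C/(‖x‖+√(−t))`, the Riesz pressure
`Q[v(t)] = RᵢRⱼ(vᵢvⱼ)` (`pressurePotential (v t)`; `∇q = ∇Q[v(t)]` by the tree's
`PineauVicol2026.gradient_pressure_eq_of_typeI_vertex`) obeys
`(‖x‖+√(−t))²|Q| ≤ K`, `(‖x‖+√(−t))³‖DQ‖ ≤ K`, `(‖x‖+√(−t))⁴‖D²Q‖ ≤ K` with `K = K(C)`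
(`apexRieszPressure_scaleInvariantBounds`).  Ingredients:

* `pressureSource_zoom`, `nearPotential_zoom`, `farPotential_zoom`, `pressurePotential_zoom` — the
  dilation covariance `Q[a • W(b·)](ξ) = a² Q[W](bξ)` of the pressure potential (change of variables in
  the two absolutely convergent integrals, the scaling laws `Γ₀^{b,2b}(z) = b⁻¹Γ₀^{1,2}(b⁻¹z)`,
  `D²Γ∞^{b,2b}(z) = b⁻³D²Γ∞^{1,2}(b⁻¹z)` of `NewtonPotential.lean`, and the independence of the cutoff
  scale `PineauVicol2026.pressurePotential_eq_scale_decay`);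
* the Navier–Stokes rescaling `w = nsRescale λ v`, `λ = max{‖x‖, √(−t)}/16`, which preserves the class
  with the SAME constant `C` (`IsClassicalNSSolutionOn.nsRescale_holds`, `HasTypeIDecay.nsRescale`) and
  normalises the point, so that `apexRieszPressure_unitScaleBounds` applies; `‖x‖ + √(−t) ≤ 32λ`.

What remains of the stub after this file and the landed `stub_apexScaleInvariantBounds_ofPressure` is the
joint SMOOTHNESS in `(t, x)` of `Q[v(t)](x)` (time regularity of the Riesz pressure), see
`…ApexScaleInvariantBounds.lean`.

## References

* B. Pineau, V. Vicol, arXiv:2607.09619 (2026), Lemma 2.1, Lemma 7.1. [PineauVicol2026]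
* G. Seregin, V. Šverák, Comm. PDE 34 (2009) = arXiv:0804.1803, §2 p. 8. [SereginSverak2009]
* J. Leray, Acta Math. 63 (1934), §20 (the rescaling). [Leray1934]
-/

noncomputable section

open MeasureTheory Set Function Filter Topology Metric
open scoped ContDiff

namespace Summit.NavierStokesRegularity.NavierStokesRegularity.Theorems.SymmetricScarExists.LogtimeBernoulli

open Literature.Analysis.FluidPDE
open Literature.Analysis.FluidPDE.FourierNS (HasDecay)
open Literature.Analysis.FluidPDE.PineauVicol2026 (newtonNearMass newtonNearMass_nonneg
  integral_closedBall_indicator_norm_sub_inv_sq_le integrable_inv_one_add_norm_pow_five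
  exists_hasDecay_fderiv_newtonFar hasDecay_two_evalDiag hasFDerivAt_integral_clm_apply_comp_sub_decay)

-- nested operator types `ℝ³ →L[ℝ] ℝ³ →L[ℝ] ℝ³ →L[ℝ] ℝ`
set_option maxSynthPendingDepth 3

/-! ### Dilation covariance of the pressure potential -/

/-- **Dilation covariance of the quadratic source**: for `V(ξ) = a • W(bξ)`, `b ≠ 0`,
`G[V](ξ) = a²b² G[W](bξ)` (`DV = ab DW(b·)`, `DV[V] = a²b DW[W](b·)`, `div V = ab (div W)(b·)`,
one more derivative). [folklore] -/
theorem pressureSource_zoom (W : (EuclideanSpace ℝ (Fin 3)) → (EuclideanSpace ℝ (Fin 3))) (a : ℝ) {b : ℝ}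
    (hb : b ≠ 0) :
    pressureSource (fun ξ => a • W (b • ξ)) =
      fun ξ => (a ^ 2 * b ^ 2) * pressureSource W (b • ξ) := by
  set V : (EuclideanSpace ℝ (Fin 3)) → (EuclideanSpace ℝ (Fin 3)) := fun ξ => a • W (b • ξ) with hV
  have hDV : fderiv ℝ V = fun η => (a * b) • fderiv ℝ W (b • η) := fderiv_const_smul_comp_smul W a hb
  set Y : (EuclideanSpace ℝ (Fin 3)) → (EuclideanSpace ℝ (Fin 3)) :=
    fun η => convect W W η + VectorCalculus.divergence W η • W η with hY
  have hYV : (fun η => convect V V η + VectorCalculus.divergence V η • V η) =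
      fun η => (a ^ 2 * b) • Y (b • η) := by
    funext η
    simp only [hY, hV, convect_apply, divergence_eq_traceCLM]
    rw [fderiv_const_smul_comp_smul W a hb]
    simp only [_root_.smul_apply, map_smul, smul_eq_mul, smul_add, smul_smul]
    congr 1 <;> (congr 1; ring)
  rw [pressureSource_def, pressureSource_def, hYV, divergence_eq_traceCLM_comp,
    divergence_eq_traceCLM_comp, fderiv_const_smul_comp_smul Y (a ^ 2 * b) hb]
  funext ξ
  simp only [Function.comp_apply, map_smul, smul_eq_mul, hY]
  ring

/-- **Dilation covariance of the near potential**: `Q₁^{1,2}[a • W(b·)](ξ) = a² Q₁^{b,2b}[W](bξ)`, `b > 0`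
(substitute `z = b⁻¹z'` and use `Γ₀^{b,2b}(z') = b⁻¹Γ₀^{1,2}(b⁻¹z')`). [folklore] -/
theorem nearPotential_zoom (W : (EuclideanSpace ℝ (Fin 3)) → (EuclideanSpace ℝ (Fin 3))) (a : ℝ) {b : ℝ}
    (hb : 0 < b) (ξ : EuclideanSpace ℝ (Fin 3)) :
    nearPotential 1 2 (fun ξ => a • W (b • ξ)) ξ = a ^ 2 * nearPotential (b * 1) (b * 2) W (b • ξ) := by
  rw [nearPotential, nearPotential, pressureSource_zoom W a hb.ne']
  dsimp only
  have e1 : ∀ z : EuclideanSpace ℝ (Fin 3), newtonNear 1 2 z * (a ^ 2 * b ^ 2 * pressureSource W (b • (ξ - z))) =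
      (a ^ 2 * b ^ 2) * (newtonNear 1 2 z * pressureSource W (b • (ξ - z))) := fun z => by ring
  simp_rw [e1]
  rw [integral_const_mul]
  have e2 : (fun z' : EuclideanSpace ℝ (Fin 3) => newtonNear (b * 1) (b * 2) z' * pressureSource W (b • ξ - z')) =
      fun z' => (fun z : EuclideanSpace ℝ (Fin 3) => b⁻¹ * (newtonNear 1 2 z * pressureSource W (b • (ξ - z)))) (b⁻¹ • z') := by
    funext z'
    dsimp only
    rw [newtonNear_scale hb, smul_sub, smul_inv_smul₀ hb.ne', mul_assoc]
  rw [e2, Measure.integral_comp_inv_smul_of_nonneg volume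
    (fun z : EuclideanSpace ℝ (Fin 3) => b⁻¹ * (newtonNear 1 2 z * pressureSource W (b • (ξ - z)))) hb.le,
    integral_const_mul, finrank_euclideanSpace_fin, smul_eq_mul]
  field_simp

/-- **Dilation covariance of the far potential**: `Q₂^{1,2}[a • W(b·)](ξ) = a² Q₂^{b,2b}[W](bξ)`, `b > 0`
(substitute `y = b⁻¹y'` and use `D²Γ∞^{b,2b}(z) = b⁻³ D²Γ∞^{1,2}(b⁻¹z)`). [folklore] -/
theorem farPotential_zoom (W : (EuclideanSpace ℝ (Fin 3)) → (EuclideanSpace ℝ (Fin 3))) (a : ℝ) {b : ℝ}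
    (hb : 0 < b) (ξ : EuclideanSpace ℝ (Fin 3)) :
    farPotential 1 2 (fun ξ => a • W (b • ξ)) ξ = a ^ 2 * farPotential (b * 1) (b * 2) W (b • ξ) := by
  rw [farPotential, farPotential]
  have e1 : ∀ η : EuclideanSpace ℝ (Fin 3),
      fderiv ℝ (fderiv ℝ (newtonFar 1 2)) (ξ - η) (a • W (b • η)) (a • W (b • η)) =
        a ^ 2 * fderiv ℝ (fderiv ℝ (newtonFar 1 2)) (ξ - η) (W (b • η)) (W (b • η)) := fun η => by
    simp only [map_smul, _root_.smul_apply, smul_eq_mul]; ring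
  simp_rw [e1]
  rw [integral_const_mul]
  have e2 : (fun η' : EuclideanSpace ℝ (Fin 3) =>
      fderiv ℝ (fderiv ℝ (newtonFar (b * 1) (b * 2))) (b • ξ - η') (W η') (W η')) =
      fun η' => (fun η : EuclideanSpace ℝ (Fin 3) =>
        b⁻¹ ^ 3 * fderiv ℝ (fderiv ℝ (newtonFar 1 2)) (ξ - η) (W (b • η)) (W (b • η))) (b⁻¹ • η') := by
    funext η'
    dsimp only
    rw [fderiv2_newtonFar_scale hb, smul_sub, inv_smul_smul₀ hb.ne', smul_inv_smul₀ hb.ne',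
      _root_.smul_apply, _root_.smul_apply, smul_eq_mul]
  rw [e2, Measure.integral_comp_inv_smul_of_nonneg volume
    (fun η : EuclideanSpace ℝ (Fin 3) =>
      b⁻¹ ^ 3 * fderiv ℝ (fderiv ℝ (newtonFar 1 2)) (ξ - η) (W (b • η)) (W (b • η))) hb.le,
    integral_const_mul, finrank_euclideanSpace_fin, smul_eq_mul]
  field_simp

/-- **Dilation covariance of the pressure potential** (the Riesz transforms commute with dilations):
`Q[a • W(b·)](ξ) = a² Q[W](bξ)` for `b > 0` and `W ∈ C²` in a decay class (`nearPotential_zoom`,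
`farPotential_zoom`, and the independence of the cutoff scale
`PineauVicol2026.pressurePotential_eq_scale_decay`). [folklore] -/
theorem pressurePotential_zoom {W : (EuclideanSpace ℝ (Fin 3)) → (EuclideanSpace ℝ (Fin 3))}
    (hW2 : ContDiff ℝ 2 W) {Cd : ℝ} (hWd : ∀ y, ‖W y‖ ≤ Cd / (1 + ‖y‖)) (a : ℝ) {b : ℝ} (hb : 0 < b)
    (ξ : EuclideanSpace ℝ (Fin 3)) :
    pressurePotential (fun ξ => a • W (b • ξ)) ξ = a ^ 2 * pressurePotential W (b • ξ) := by
  rw [pressurePotential, nearPotential_zoom W a hb, farPotential_zoom W a hb,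
    PineauVicol2026.pressurePotential_eq_scale_decay hb hW2 hWd (b • ξ)]
  ring




/-! ### The scale-invariant bounds in physical variables -/

/-- **Registered sub-goal `apexRieszPressure_scaleInvariantBounds`: scale-invariant pointwise bounds for
the Riesz pressure of a classical Type-I solution on the past.**  For every `C` there is `K = K(C)` with
`(‖x‖+√(−t))² |Q[v(t)](x)| ≤ K`, `(‖x‖+√(−t))³ ‖DQ[v(t)](x)‖ ≤ K`, `(‖x‖+√(−t))⁴ ‖D²Q[v(t)](x)‖ ≤ K` for all
`t < 0`, `x`, and every classical solution `(v, q)` of Navier–Stokes (`ν = 1`, `f = 0`) on `(−∞, 0)` with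
`‖v(t,x)‖ ≤ C/(‖x‖+√(−t))` (`Q = pressurePotential`, the Riesz pressure `RᵢRⱼ(vᵢvⱼ)`).  Proof: rescale by
`λ = max{‖x‖, √(−t)}/16` — `w = nsRescale λ v` is again a classical Type-I solution with the SAME `C`
(`IsClassicalNSSolutionOn.nsRescale_holds`, `HasTypeIDecay.nsRescale`), the point becomes `(s, y)` with
`max{‖y‖, √(−s)} = 16`, `v(t) = λ⁻¹ • w(s)(λ⁻¹ ·)` and `Q[v(t)] = λ⁻² Q[w(s)](λ⁻¹ ·)` (`pressurePotential_zoom`);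
the unit-scale bounds `apexRieszPressure_unitScaleBounds` and `‖x‖ + √(−t) ≤ 32λ` give the claim with
`K = 32⁴ K_unit`. [cite: SereginSverak2009, §2 p. 8] -/
theorem apexRieszPressure_scaleInvariantBounds :
    ∀ (C : ℝ), ∃ (K : ℝ), 0 ≤ K ∧ ∀ (v : ℝ → EuclideanSpace ℝ (Fin 3) → EuclideanSpace ℝ (Fin 3)) (q : ℝ → EuclideanSpace ℝ (Fin 3) → ℝ), Literature.Analysis.FluidPDE.IsClassicalNSSolutionOn (Set.Iio 0) 1 0 v q → Literature.Analysis.FluidPDE.HasTypeIDecay C v → ∀ t < (0 : ℝ), ∀ (x : EuclideanSpace ℝ (Fin 3)), (‖x‖ + Real.sqrt (-t)) ^ 2 * |Literature.Analysis.FluidPDE.pressurePotential (v t) x| ≤ K ∧ (‖x‖ + Real.sqrt (-t)) ^ 3 * ‖fderiv ℝ (Literature.Analysis.FluidPDE.pressurePotential (v t)) x‖ ≤ K ∧ (‖x‖ + Real.sqrt (-t)) ^ 4 * ‖iteratedFDeriv ℝ 2 (Literature.Analysis.FluidPDE.pressurePotential (v t)) x‖ ≤ K := by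
  intro C
  obtain ⟨K₀, hK₀0, hK₀⟩ := apexRieszPressure_unitScaleBounds C
  refine ⟨32 ^ 4 * K₀, by positivity, fun v q hsol hdec t ht x => ?_⟩
  -- the scale of the point
  set m : ℝ := max ‖x‖ (Real.sqrt (-t)) with hm
  have hst : 0 < Real.sqrt (-t) := Real.sqrt_pos.2 (by linarith)
  have hm0 : 0 < m := lt_max_of_lt_right hst
  set lam : ℝ := m / 16 with hlam
  have hlam0 : 0 < lam := by rw [hlam]; positivity
  have hlam2 : 0 < lam ^ 2 := by positivity
  -- the rescaled solution
  set w : ℝ → (EuclideanSpace ℝ (Fin 3)) → (EuclideanSpace ℝ (Fin 3)) := nsRescale lam v with hw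
  have hsolw : IsClassicalNSSolutionOn (Iio 0) 1 0 w (nsRescalePressure lam q) := by
    have h := IsClassicalNSSolutionOn.nsRescale_holds hsol hlam0
    rw [Set.preimage_const_mul_Iio₀ (0 : ℝ) hlam2, zero_div, nsRescaleForce_zero] at h
    exact h
  have hdecw : HasTypeIDecay C w := hdec.nsRescale hlam0
  -- the normalised point
  set s : ℝ := t / lam ^ 2 with hs
  set y : EuclideanSpace ℝ (Fin 3) := lam⁻¹ • x with hy
  have hs0 : s < 0 := div_neg_of_neg_of_pos ht hlam2
  have hts : lam ^ 2 * s = t := by rw [hs]; field_simp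
  have hxy : lam • y = x := by rw [hy, smul_inv_smul₀ hlam0.ne']
  have hys : max ‖y‖ (Real.sqrt (-s)) = 16 := by
    have e1 : ‖y‖ = lam⁻¹ * ‖x‖ := by rw [hy, norm_smul, norm_inv, Real.norm_of_nonneg hlam0.le]
    have e2 : Real.sqrt (-s) = lam⁻¹ * Real.sqrt (-t) := by
      rw [hs, show -(t / lam ^ 2) = -t / lam ^ 2 by ring, Real.sqrt_div' _ hlam2.le,
        Real.sqrt_sq hlam0.le]
      ring
    rw [e1, e2, ← mul_max_of_nonneg _ _ (inv_nonneg.2 hlam0.le), ← hm, hlam]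
    field_simp
  -- the slice identity `v t = λ⁻¹ • w(s, λ⁻¹ ·)`
  have hslice : v t = fun ξ => lam⁻¹ • w s (lam⁻¹ • ξ) := by
    funext ξ
    rw [hw, nsRescale_apply, hts, smul_inv_smul₀ hlam0.ne', smul_smul, inv_mul_cancel₀ hlam0.ne',
      one_smul]
  -- the slice of `w` at `s`: smoothness and decay class
  have hws : ContDiff ℝ ∞ (w s) := hsolw.contDiff_velocity hs0
  have hws2 : ContDiff ℝ 2 (w s) := hws.of_le (by norm_cast)
  have hws4 : ContDiff ℝ 4 (w s) := hws.of_le (by norm_cast)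
  have hσ0 : 0 < Real.sqrt (-s) := Real.sqrt_pos.2 (by linarith)
  have hv' : ∀ z, ‖w s z‖ ≤ C / (‖z - 0‖ + Real.sqrt (-s)) := fun z => by
    rw [sub_zero]; exact hdecw s hs0 z
  have hWd : ∀ z, ‖w s z‖ ≤ C * (1 + ‖(0 : EuclideanSpace ℝ (Fin 3))‖ + Real.sqrt (-s)) /
      min (Real.sqrt (-s)) 1 / (1 + ‖z‖) := fun z => PineauVicol2026.decay_of_profile hσ0 hv' z
  -- covariance of the pressure potential
  set Q : (EuclideanSpace ℝ (Fin 3)) → ℝ := pressurePotential (w s) with hQ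
  have hQ2 : ContDiff ℝ 2 Q := PineauVicol2026.contDiff_pressurePotential_decay hws4 hWd
  set g : (EuclideanSpace ℝ (Fin 3)) → ℝ := lam⁻¹ • Q with hg
  have hg2 : ContDiff ℝ 2 g := hQ2.const_smul lam⁻¹
  have hcov : pressurePotential (v t) = fun ξ => lam⁻¹ • g (lam⁻¹ • (ξ - 0)) := by
    funext ξ
    rw [hslice, pressurePotential_zoom hws2 hWd lam⁻¹ (inv_pos.2 hlam0) ξ, sub_zero]
    simp only [hg, Pi.smul_apply, smul_eq_mul, hQ]
    ring
  -- the unit-scale bounds at `(s, y)`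
  obtain ⟨b0, b1, b2⟩ := hK₀ w _ hsolw hdecw s hs0 y hys
  have hy' : lam⁻¹ • (x - 0) = y := by rw [sub_zero]
  have hgn : ∀ n ≤ 2, ‖iteratedFDeriv ℝ n g y‖ = lam⁻¹ * ‖iteratedFDeriv ℝ n Q y‖ := by
    intro n hn
    rw [hg, iteratedFDeriv_const_smul_apply (hQ2.of_le (by exact_mod_cast hn)).contDiffAt, norm_smul,
      norm_inv, Real.norm_of_nonneg hlam0.le]
  have hunzoom : ∀ n ≤ 2, ‖iteratedFDeriv ℝ n (pressurePotential (v t)) x‖ ≤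
      lam⁻¹ ^ (n + 2) * ‖iteratedFDeriv ℝ n Q y‖ := by
    intro n hn
    rw [hcov]
    refine (PineauVicol2026.norm_iteratedFDeriv_unzoom_le (hg2.of_le (by exact_mod_cast hn)) hlam0 0 x).trans ?_
    rw [hy', hgn n hn, pow_succ (lam⁻¹) (n + 1)]
    ring_nf
    rfl
  -- the weight `‖x‖ + √(-t) ≤ 32 λ`
  have hR : ‖x‖ + Real.sqrt (-t) ≤ 32 * lam := by
    have h1 : ‖x‖ ≤ m := le_max_left _ _
    have h2 : Real.sqrt (-t) ≤ m := le_max_right _ _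
    rw [hlam]; linarith
  have hR0 : 0 ≤ ‖x‖ + Real.sqrt (-t) := by positivity
  have hRn : ∀ n : ℕ, (‖x‖ + Real.sqrt (-t)) ^ (n + 2) * lam⁻¹ ^ (n + 2) ≤ 32 ^ (n + 2) := by
    intro n
    calc (‖x‖ + Real.sqrt (-t)) ^ (n + 2) * lam⁻¹ ^ (n + 2) ≤ (32 * lam) ^ (n + 2) * lam⁻¹ ^ (n + 2) :=
          mul_le_mul_of_nonneg_right (pow_le_pow_left₀ hR0 hR _) (by positivity)
      _ = 32 ^ (n + 2) * (lam * lam⁻¹) ^ (n + 2) := by rw [mul_pow, mul_pow]; ring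
      _ = 32 ^ (n + 2) := by rw [mul_inv_cancel₀ hlam0.ne', one_pow, mul_one]
  have h32 : ∀ n ≤ 2, (32 : ℝ) ^ (n + 2) * K₀ ≤ 32 ^ 4 * K₀ := fun n hn =>
    mul_le_mul_of_nonneg_right (pow_le_pow_right₀ (by norm_num) (by omega)) hK₀0
  have key : ∀ n ≤ 2, ‖iteratedFDeriv ℝ n Q y‖ ≤ K₀ →
      (‖x‖ + Real.sqrt (-t)) ^ (n + 2) * ‖iteratedFDeriv ℝ n (pressurePotential (v t)) x‖ ≤ 32 ^ 4 * K₀ := by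
    intro n hn hb
    calc (‖x‖ + Real.sqrt (-t)) ^ (n + 2) * ‖iteratedFDeriv ℝ n (pressurePotential (v t)) x‖
        ≤ (‖x‖ + Real.sqrt (-t)) ^ (n + 2) * (lam⁻¹ ^ (n + 2) * ‖iteratedFDeriv ℝ n Q y‖) :=
          mul_le_mul_of_nonneg_left (hunzoom n hn) (by positivity)
      _ = (‖x‖ + Real.sqrt (-t)) ^ (n + 2) * lam⁻¹ ^ (n + 2) * ‖iteratedFDeriv ℝ n Q y‖ := by ring
      _ ≤ 32 ^ (n + 2) * K₀ := mul_le_mul (hRn n) hb (norm_nonneg _) (by positivity)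
      _ ≤ 32 ^ 4 * K₀ := h32 n hn
  refine ⟨?_, ?_, ?_⟩
  · have h := key 0 (by norm_num) (by rw [norm_iteratedFDeriv_zero, Real.norm_eq_abs]; exact b0)
    rwa [norm_iteratedFDeriv_zero, Real.norm_eq_abs] at h
  · have h := key 1 (by norm_num) (by rw [norm_iteratedFDeriv_one]; exact b1)
    rwa [norm_iteratedFDeriv_one] at h
  · exact key 2 le_rfl b2


end Summit.NavierStokesRegularity.NavierStokesRegularity.Theorems.SymmetricScarExists.LogtimeBernoulli
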